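import Literature.Geometry.Riemannian.SegmentsAreGeodesics
import Literature.Geometry.Riemannian.CutLocusBishopExp
import HarnessLib

/-!
# Points with two minimal geodesics from `p` are cut points of `p` (Lee 2018, Prop. 10.32 (a))

Clause (2) of the named fact `cutLocus_isClosed_and_mem_of_two_le` (`CutLocusBishop.lean`), now
a theorem: on a connected Riemannian manifold (smooth metric, Hausdorff, without boundary) all of
whose closed distance balls are compact, every point `q` joined to `p` by at least two distinct
minimal geodesics (`minimalGeodesicMultiplicity g hg p q ≥ 2`, counted by midpoints) is a cut
point of `p` (`q ∈ cutLocus g hg p`, the metric cut locus of `CutLocus.lean`). This is the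
uniqueness statement of Lee, Prop. 10.32 (a) ("`γ_v|[0,b]` … is the unique unit-speed minimizing
curve" before the cut time) read contrapositively. Proof: the reduction
`mem_cutLocus_of_two_le_multiplicity_of_nonbranching` (`CutLocusBishopProofs.lean`) to the
non-branching of unit-speed metric segments, which is `unitSpeed_segment_nonbranching`
(`SegmentsAreGeodesics.lean`: metric segments are geodesics, and geodesics are determined by
their restriction to an interval), the Levi-Civita connection of such a manifold being
geodesically complete (`isGeodesicallyComplete_of_isCompact_closedBall`).

No definitions and no named facts are introduced (D-0026).

## References

* J. M. Lee, *Introduction to Riemannian Manifolds*, 2nd ed. (2018), Thm. 6.4, Prop. 10.32 (a).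
  [LeeRiemannianManifolds2018]
-/

noncomputable section

open Bundle Set Filter Function Manifold
open scoped Manifold ContDiff Topology ENNReal NNReal

namespace Literature.Geometry.Riemannian

open Literature.Geometry.Lorentzian
open Literature.Geometry.Lorentzian.PseudoRiemannianMetric

/-- **A point reached from `p` by two distinct minimal geodesics is a cut point of `p`**
(Lee 2018, Prop. 10.32 (a), contrapositive: before the cut time the minimizing geodesic is the
unique unit-speed minimizing curve), for the metric notions of `CutLocus.lean`: on a connected
Riemannian manifold with smooth metric, Hausdorff and without boundary, whose closed distance
balls are compact, `minimalGeodesicMultiplicity g hg p q ≥ 2 → q ∈ cutLocus g hg p`. This is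
clause (2) of `cutLocus_isClosed_and_mem_of_two_le`.
[cite: LeeRiemannianManifolds2018, Prop. 10.32 (a)] -/
theorem mem_cutLocus_of_two_le_minimalGeodesicMultiplicity
    {E : Type*} [NormedAddCommGroup E] [NormedSpace ℝ E] [FiniteDimensional ℝ E]
    {H : Type*} [TopologicalSpace H] (I : ModelWithCorners ℝ E H) [I.Boundaryless]
    {M : Type*} [TopologicalSpace M] [ChartedSpace H M] [IsManifold I ∞ M]
    [T2Space M] [ConnectedSpace M]
    (g : PseudoRiemannianMetric I ∞ E (TangentSpace I : M → Type _)) (hg : g.IsRiemannian)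
    (hc : ∀ (x : M) (r : ℝ≥0), IsCompact {y | g.edist hg x y ≤ r})
    {p q : M} (h2 : 2 ≤ minimalGeodesicMultiplicity g hg p q) : q ∈ cutLocus g hg p := by
  haveI : CompleteSpace E := FiniteDimensional.complete ℝ E
  haveI : g.HasLeviCivita := g.hasLeviCivita
  haveI : CovariantDerivative.ContMDiffCovariantDerivative g.leviCivita 1 :=
    ⟨g.isLocallyContMDiff_leviCivita_holds 1
      (by rw [show ((1 : ℕ∞) : ℕ∞ω) + 1 = 2 by norm_num]; exact WithTop.coe_le_coe.2 le_top)
      univ isOpen_univ⟩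
  have hcompl : IsGeodesicallyComplete g.leviCivita :=
    isGeodesicallyComplete_of_isCompact_closedBall hg hc
  exact mem_cutLocus_of_two_le_multiplicity_of_nonbranching hg hc
    (fun σ₁ σ₂ ℓ a b ha hab hb h₁ h₂ heq ↦
      unitSpeed_segment_nonbranching g le_rfl hg hcompl σ₁ σ₂ ℓ a b ha hab hb h₁ h₂ heq) h2

end Literature.Geometry.Riemannian
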